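import Summits.QuantumFields.YangMills.Theorems.UnitScaleTiltProp7FlatSourcedMeanValue
import Summits.QuantumFields.YangMills.Theorems.UnitScaleTiltProp7PinnedFlatComponent
import Literature.MathematicalPhysics.QuantumFieldTheory.Balaban1983to89.B5Ineq137Torus
import Literature.MathematicalPhysics.QuantumFieldTheory.Balaban1983to89.B5Eq118OneStroke
import Literature.MathematicalPhysics.QuantumFieldTheory.Balaban1983to89.B10StarCount
import Literature.Barriers.QuantumFields.UnitaryHaarSmallBall
import HarnessLib

/-!
# Route R of crux K1 «MinimiserStabilityRegPr» (stmt-QuantumFields-19200) — THE SOURCED INTERIOR MEAN-VALUE ESTIMATE FOR MATRIX-VALUED BOND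
# FIELDS ON THE TORUS, AND ITS READING ON THE TWO `k`-BLOCKS OF A COARSE BOND (operator norm; `curl 1`∕`diverg 1` of `LatticeFieldCalculus`;
# the consumer's letters `iterBlockOf k b.src ∈ {c₋, c₊}`, base corner `fine P k c₋`) — brick 2d of the flat linear interior-regularity core
# (cell `ym3-torus`, width seat `ym-ust-19200-w1` g6; OWNER ACK 22 (a); `--supports stmt-QuantumFields-19200 --as helper`, count-neutral)

YM₃ on T³ is a RUNG of the ladder (R3), not the Clay problem; nothing here claims the stub, the crux or the gap.

WHY.  Route R's representatives are matrix-valued bond fields `Y_b = W_bU_b^* − 1 ∈ M_N(ℂ)` measured in the operator norm, and the `ℓ²` bookkeeping of the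
`Q^{(k)}`-defect source (`Prop7FibreQDefectEll2`, p611573; the flat pinned knit `Prop7PinnedFlatFibrePassage`, p613016) reads a local sup `ρ_c ≥ ‖W_b − 1‖` over the
fine bonds `b` issued from the two `k`-blocks of a coarse bond `c` (`iterBlockOf k b.src ∈ {c.src, c.tgt}`).  Brick 2c (`Prop7FlatSourcedMeanValue`) states the
sourced interior estimate for REAL bond fields through the periodic pullback along `transl x₀`.  This file does the two remaining pieces of bookkeeping: (i) the
`2N²` real components (real∕imaginary parts of the entries are `ℝ`-linear readings commuting with `curl 1`∕`diverg 1`, `Prop7PinnedFlatCoercivity.map_curl`∕`map_diverg`;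
operator² ≤ Frobenius ≤ `N`·operator², `MatrixNorms`), and (ii) the dictionary from the consumer's block letters to the pullback: base corner `x₀ := fine P k c.src`
(`B5Ineq137Torus.fine`, label `L^k·c_κ`) and offsets `0 ≤ z_κ ≤ 2L^k − 1` (wrap-around of the coarse torus in the bond direction included).

WHAT IS PROVED (sorry-free, no definition; `ℓ` the Caccioppoli scale, `K := 2^d(1+56d)^d∕(ℓ+1)^d`, `R := ρ₀ + ℓ + d(ℓ+2)`,
`T := (4K(2R+1)^d + 2)·(64·2^d·d·(c₁+c₂)·(2R+1))²`).
* §1 (entries ≤ operator norm: `Literature.Barriers.QuantumFields.norm_entry_le_l2_opNorm`, reused) `sum_sum_norm_sq_le_mul_opNorm_sq` (`Σ_{a,b}‖M a b‖² ≤ N‖M‖²`), `sq_reading_le` (brick 2c for one real reading `e ↦ π(Y e)`, `|π M| ≤ ‖M‖`),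
  ★★ `normSq_le_of_curl_diverg_bounds_torus` — `‖curl 1 Y‖ ≤ c₁` on the plaquettes based in `transl x₀ '' Q_{R+1}(0)`, `‖diverg 1 Y‖ ≤ c₂` on `transl x₀ '' Q_{R+2}(0)`
  ⟹ for `z′ ∈ Q_{ρ₀}(0)`, `μ`: `‖Y⟨transl x₀ z′, μ⟩‖² ≤ 4K·N·Σ_{w ∈ Q_R(0)} ‖Y⟨transl x₀ w, μ⟩‖² + 2N²·T`.
* §2 `mul_le_and_lt_of_div_eq`, `fine_add_cast_eq`, `exists_offset_of_iterBlockOf_eq` (one block: `x = transl (fine P k y) z`, `0 ≤ z ≤ L^k − 1`),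
  ★ `exists_offset_of_iterBlockOf_eq_or_shift` (two blocks `{y, y + e_κ₀}`: `0 ≤ z_κ ≤ 2L^k − 1`), `offset_mem_box`.
* §3 ★★ `normSq_le_of_curl_diverg_bounds_twoBlock` — `k ≤ m + K`, `c : PBond P k`, `ρ₀ = 2L^k`, Caccioppoli scale `L^k`, `x₀ = fine P k c.src`: under the same
  curl∕divergence bounds, for EVERY fine bond `b` with `iterBlockOf k b.src = c.src ∨ iterBlockOf k b.src = c.tgt`:
  `‖Y b‖² ≤ 4K·N·Σ_{w ∈ Q_R(0)} ‖Y⟨transl x₀ w, b.dir⟩‖² + 2N²·T` — `K(2R+1)^d ≤ 2^d(1+56d)^d(2d+7)^d` is a pure number, so this reads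
  `sup_{B^k(c₋)∪B^k(c₊)}‖Y‖² ≤ C_d·N·(L^k)^{−d}·(pullback mass over Q_R) + C′_d·N²·(L^k)²·(c₁+c₂)²`, k-UNIFORM.

HONEST SCOPE.  [folklore] bookkeeping + label arithmetic over brick 2c; flat and LINEAR; the right side is the PULLBACK box sum (= the plain sum over the
`(2R+1)^d` fine sites when `2R+1 ≤ sitesPerDir 0`, `B10Eq71TorusLocal.transl_injOn`; a stencil-overlap count `hν` is the consumer's); the nonlinear bootstrap and
the centre charges of the pinned representative are not here (★p1's fork).  Nothing of Bałaban's is asserted.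

References: M. Giaquinta, Princeton UP 1983 [Giaquinta1984] (Ch. III §2); T. Bałaban, CMP 95 (1984) 17–40 [Balaban1984PropagatorsI] ((1.6) p.18, (1.21) p.21);
CMP 96 (1984) 223–250 [Balaban1984PropagatorsII] ((1.9) p.226).
-/

set_option autoImplicit false

noncomputable section

open scoped BigOperators Matrix.Norms.L2Operator
open Finset

namespace Summit.QuantumFields.YangMills.Theorems.Prop7FlatSourcedMeanValueMatrix

open Literature.MathematicalPhysics.QuantumFieldTheory.Balaban1983to89
open B4Eq19LatticeOperators
open LatticeFieldCalculus (curl diverg)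
open B10Eq27TorusAxialLog (transl transl_apply)
open B5Ineq137Torus (fine fine_val pow_mul_sitesPerDir)
open B5Eq118OneStroke (iterBlockOf val_iterBlockOf)
open Summit.QuantumFields.YangMills.Theorems.Prop7FlatSourcedMeanValue (sq_le_of_curl_diverg_bounds_torus)
open Summit.QuantumFields.YangMills.Theorems.Prop7PinnedFlatCoercivity (map_curl map_diverg exists_reEntry exists_imEntry)

variable {P : Params} {j k N : ℕ}

/-! ## §1 Matrix-valued bond fields: the `2N²` real components of brick 2c -/

/-- Frobenius ≤ `N`·operator²: `Σ_{a,b} ‖M a b‖² ≤ N·‖M‖²`. [folklore] -/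
theorem sum_sum_norm_sq_le_mul_opNorm_sq (M : Matrix (Fin N) (Fin N) ℂ) :
    ∑ a : Fin N, ∑ b : Fin N, ‖M a b‖ ^ 2 ≤ N * ‖M‖ ^ 2 := by
  rw [Finset.sum_comm]
  calc ∑ b : Fin N, ∑ a : Fin N, ‖M a b‖ ^ 2 ≤ ∑ _b : Fin N, ‖M‖ ^ 2 :=
        Finset.sum_le_sum fun b _ => MatrixNorms.sum_norm_sq_col_le_opNorm_sq M b
    _ = N * ‖M‖ ^ 2 := by rw [Finset.sum_const, Finset.card_univ, Fintype.card_fin, nsmul_eq_mul]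

/-- **Brick 2c for one real reading.**  If `π : M_N(ℂ) →ₗ[ℝ] ℝ` satisfies `|π M| ≤ ‖M‖`, then the real bond field `e ↦ π(Y e)` inherits the curl and
divergence bounds of `Y` (`map_curl`∕`map_diverg`) and `sq_le_of_curl_diverg_bounds_torus` applies to it. [folklore] -/
theorem sq_reading_le (hd : 1 ≤ P.d) (x₀ : Site P j) (Y : PBond P j → Matrix (Fin N) (Fin N) ℂ) (π : Matrix (Fin N) (Fin N) ℂ →ₗ[ℝ] ℝ)
    (hπ : ∀ M, |π M| ≤ ‖M‖) {ℓ : ℕ} (hℓ : 1 ≤ ℓ) {ρ₀ : ℤ} (hρ₀ : 0 ≤ ρ₀) {c₁ c₂ : ℝ} (hc₁ : 0 ≤ c₁) (hc₂ : 0 ≤ c₂)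
    (hC : ∀ w ∈ box (0 : Zd P.d) (ρ₀ + ℓ + P.d * ((ℓ : ℤ) + 2) + 1), ∀ (ν μ : Fin P.d) (hνμ : ν < μ),
      ‖curl 1 Y ⟨transl x₀ w, ν, μ, hνμ⟩‖ ≤ c₁)
    (hDv : ∀ w ∈ box (0 : Zd P.d) (ρ₀ + ℓ + P.d * ((ℓ : ℤ) + 2) + 2), ‖diverg 1 Y (transl x₀ w)‖ ≤ c₂)
    {z' : Zd P.d} (hz' : z' ∈ box (0 : Zd P.d) ρ₀) (μ : Fin P.d) :
    (π (Y ⟨transl x₀ z', μ⟩)) ^ 2 ≤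
      4 * ((2 : ℝ) ^ P.d * (1 + 56 * P.d) ^ P.d / ((ℓ : ℝ) + 1) ^ P.d) *
          ∑ w ∈ box (0 : Zd P.d) (ρ₀ + ℓ + P.d * ((ℓ : ℤ) + 2)), (π (Y ⟨transl x₀ w, μ⟩)) ^ 2 +
        (4 * ((2 : ℝ) ^ P.d * (1 + 56 * P.d) ^ P.d / ((ℓ : ℝ) + 1) ^ P.d) * (2 * ((ρ₀ + ℓ + P.d * ((ℓ : ℤ) + 2) : ℤ) : ℝ) + 1) ^ P.d + 2) *
          (64 * (2 : ℝ) ^ P.d * P.d * (c₁ + c₂) * (2 * ((ρ₀ + ℓ + P.d * ((ℓ : ℤ) + 2) : ℤ) : ℝ) + 1)) ^ 2 := by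
  refine sq_le_of_curl_diverg_bounds_torus hd x₀ (fun e => π (Y e)) hℓ hρ₀ hc₁ hc₂ (fun w hw ν μ' hνμ => ?_) (fun w hw => ?_) hz' μ
  · rw [← map_curl π Y]
    exact (hπ _).trans (hC w hw ν μ' hνμ)
  · rw [← map_diverg π Y]
    exact (hπ _).trans (hDv w hw)

/-- ★★ **THE SOURCED MEAN-VALUE ESTIMATE FOR MATRIX-VALUED BOND FIELDS ON THE TORUS (operator norm).**  `d ≥ 1`, `ℓ ≥ 1`, `ρ₀ ≥ 0`, `c₁, c₂ ≥ 0`,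
`R := ρ₀ + ℓ + d(ℓ+2)`; if `‖curl 1 Y‖ ≤ c₁` on every plaquette based at a site `transl x₀ w`, `w ∈ Q_{R+1}(0)`, and `‖diverg 1 Y (transl x₀ w)‖ ≤ c₂` for
`w ∈ Q_{R+2}(0)`, then for every `z′ ∈ Q_{ρ₀}(0)` and every direction `μ`:
`‖Y⟨transl x₀ z′, μ⟩‖² ≤ 4K·N·Σ_{w ∈ Q_R(0)} ‖Y⟨transl x₀ w, μ⟩‖² + 2N²·(4K(2R+1)^d + 2)·(64·2^d·d·(c₁+c₂)·(2R+1))²`, `K = 2^d(1+56d)^d(ℓ+1)^{−d}`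
(operator² ≤ Σ entries² = Σ (re² + im²), each real part by `sq_reading_le`, and Σ entries² ≤ N·operator²). [folklore]
[cite: Giaquinta1984, Ch. III §2 (2.5) p.78; Balaban1984PropagatorsI, (1.21) p.21; Balaban1984PropagatorsII, (1.9) p.226] -/
theorem normSq_le_of_curl_diverg_bounds_torus (hd : 1 ≤ P.d) (x₀ : Site P j) (Y : PBond P j → Matrix (Fin N) (Fin N) ℂ)
    {ℓ : ℕ} (hℓ : 1 ≤ ℓ) {ρ₀ : ℤ} (hρ₀ : 0 ≤ ρ₀) {c₁ c₂ : ℝ} (hc₁ : 0 ≤ c₁) (hc₂ : 0 ≤ c₂)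
    (hC : ∀ w ∈ box (0 : Zd P.d) (ρ₀ + ℓ + P.d * ((ℓ : ℤ) + 2) + 1), ∀ (ν μ : Fin P.d) (hνμ : ν < μ),
      ‖curl 1 Y ⟨transl x₀ w, ν, μ, hνμ⟩‖ ≤ c₁)
    (hDv : ∀ w ∈ box (0 : Zd P.d) (ρ₀ + ℓ + P.d * ((ℓ : ℤ) + 2) + 2), ‖diverg 1 Y (transl x₀ w)‖ ≤ c₂)
    {z' : Zd P.d} (hz' : z' ∈ box (0 : Zd P.d) ρ₀) (μ : Fin P.d) :
    ‖Y ⟨transl x₀ z', μ⟩‖ ^ 2 ≤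
      4 * ((2 : ℝ) ^ P.d * (1 + 56 * P.d) ^ P.d / ((ℓ : ℝ) + 1) ^ P.d) * N *
          ∑ w ∈ box (0 : Zd P.d) (ρ₀ + ℓ + P.d * ((ℓ : ℤ) + 2)), ‖Y ⟨transl x₀ w, μ⟩‖ ^ 2 +
        2 * (N : ℝ) ^ 2 * ((4 * ((2 : ℝ) ^ P.d * (1 + 56 * P.d) ^ P.d / ((ℓ : ℝ) + 1) ^ P.d) *
            (2 * ((ρ₀ + ℓ + P.d * ((ℓ : ℤ) + 2) : ℤ) : ℝ) + 1) ^ P.d + 2) *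
          (64 * (2 : ℝ) ^ P.d * P.d * (c₁ + c₂) * (2 * ((ρ₀ + ℓ + P.d * ((ℓ : ℤ) + 2) : ℤ) : ℝ) + 1)) ^ 2) := by
  classical
  set K4 : ℝ := 4 * ((2 : ℝ) ^ P.d * (1 + 56 * P.d) ^ P.d / ((ℓ : ℝ) + 1) ^ P.d) with hK4
  set T : ℝ := (4 * ((2 : ℝ) ^ P.d * (1 + 56 * P.d) ^ P.d / ((ℓ : ℝ) + 1) ^ P.d) *
      (2 * ((ρ₀ + ℓ + P.d * ((ℓ : ℤ) + 2) : ℤ) : ℝ) + 1) ^ P.d + 2) *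
    (64 * (2 : ℝ) ^ P.d * P.d * (c₁ + c₂) * (2 * ((ρ₀ + ℓ + P.d * ((ℓ : ℤ) + 2) : ℤ) : ℝ) + 1)) ^ 2 with hT
  set B := box (0 : Zd P.d) (ρ₀ + ℓ + P.d * ((ℓ : ℤ) + 2)) with hB
  set x := transl x₀ z' with hx
  have hK4pos : 0 ≤ K4 := by rw [hK4]; positivity
  -- each real component
  have hre : ∀ a b : Fin N, ((Y ⟨x, μ⟩) a b).re ^ 2 ≤ K4 * ∑ w ∈ B, ((Y ⟨transl x₀ w, μ⟩) a b).re ^ 2 + T := by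
    intro a b
    obtain ⟨π, hπ⟩ := exists_reEntry (N := N) a b
    have hπb : ∀ M : Matrix (Fin N) (Fin N) ℂ, |π M| ≤ ‖M‖ := fun M => by
      rw [hπ]; exact (Complex.abs_re_le_norm _).trans (Literature.Barriers.QuantumFields.norm_entry_le_l2_opNorm M a b)
    have h := sq_reading_le hd x₀ Y π hπb hℓ hρ₀ hc₁ hc₂ hC hDv hz' μ
    simp only [hπ] at h
    rw [hK4, hT, hB, hx]
    exact h
  have him : ∀ a b : Fin N, ((Y ⟨x, μ⟩) a b).im ^ 2 ≤ K4 * ∑ w ∈ B, ((Y ⟨transl x₀ w, μ⟩) a b).im ^ 2 + T := by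
    intro a b
    obtain ⟨π, hπ⟩ := exists_imEntry (N := N) a b
    have hπb : ∀ M : Matrix (Fin N) (Fin N) ℂ, |π M| ≤ ‖M‖ := fun M => by
      rw [hπ]; exact (Complex.abs_im_le_norm _).trans (Literature.Barriers.QuantumFields.norm_entry_le_l2_opNorm M a b)
    have h := sq_reading_le hd x₀ Y π hπb hℓ hρ₀ hc₁ hc₂ hC hDv hz' μ
    simp only [hπ] at h
    rw [hK4, hT, hB, hx]
    exact h
  -- the entrywise (Frobenius) sum
  have hsq : ∀ (M : Matrix (Fin N) (Fin N) ℂ) (a b : Fin N), ‖M a b‖ ^ 2 = (M a b).re ^ 2 + (M a b).im ^ 2 := fun M a b => by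
    rw [Complex.sq_norm, Complex.normSq_apply]; ring
  have hfrob : ∑ a : Fin N, ∑ b : Fin N, ‖(Y ⟨x, μ⟩) a b‖ ^ 2 ≤
      K4 * ∑ w ∈ B, (∑ a : Fin N, ∑ b : Fin N, ‖(Y ⟨transl x₀ w, μ⟩) a b‖ ^ 2) + 2 * (N : ℝ) ^ 2 * T := by
    calc ∑ a : Fin N, ∑ b : Fin N, ‖(Y ⟨x, μ⟩) a b‖ ^ 2
        = ∑ a : Fin N, ∑ b : Fin N, (((Y ⟨x, μ⟩) a b).re ^ 2 + ((Y ⟨x, μ⟩) a b).im ^ 2) := by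
          simp only [hsq]
      _ ≤ ∑ a : Fin N, ∑ b : Fin N, ((K4 * ∑ w ∈ B, ((Y ⟨transl x₀ w, μ⟩) a b).re ^ 2 + T) +
            (K4 * ∑ w ∈ B, ((Y ⟨transl x₀ w, μ⟩) a b).im ^ 2 + T)) :=
          Finset.sum_le_sum fun a _ => Finset.sum_le_sum fun b _ => add_le_add (hre a b) (him a b)
      _ = ∑ a : Fin N, ∑ b : Fin N, (K4 * ∑ w ∈ B, ‖(Y ⟨transl x₀ w, μ⟩) a b‖ ^ 2 + 2 * T) := by
          refine Finset.sum_congr rfl fun a _ => Finset.sum_congr rfl fun b _ => ?_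
          simp only [hsq, Finset.sum_add_distrib]
          ring
      _ = K4 * ∑ w ∈ B, (∑ a : Fin N, ∑ b : Fin N, ‖(Y ⟨transl x₀ w, μ⟩) a b‖ ^ 2) + 2 * (N : ℝ) ^ 2 * T := by
          simp only [Finset.sum_add_distrib, Finset.sum_const, Finset.card_univ, Fintype.card_fin, nsmul_eq_mul, ← Finset.mul_sum]
          have e3 : (∑ a : Fin N, ∑ b : Fin N, ∑ w ∈ B, ‖(Y ⟨transl x₀ w, μ⟩) a b‖ ^ 2) =
              ∑ w ∈ B, ∑ a : Fin N, ∑ b : Fin N, ‖(Y ⟨transl x₀ w, μ⟩) a b‖ ^ 2 := by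
            calc (∑ a : Fin N, ∑ b : Fin N, ∑ w ∈ B, ‖(Y ⟨transl x₀ w, μ⟩) a b‖ ^ 2)
                = ∑ a : Fin N, ∑ w ∈ B, ∑ b : Fin N, ‖(Y ⟨transl x₀ w, μ⟩) a b‖ ^ 2 :=
                  Finset.sum_congr rfl fun a _ => Finset.sum_comm
              _ = ∑ w ∈ B, ∑ a : Fin N, ∑ b : Fin N, ‖(Y ⟨transl x₀ w, μ⟩) a b‖ ^ 2 := Finset.sum_comm
          rw [e3]
          ring
  -- operator² ≤ Frobenius ≤ N·operator²
  have hop := MatrixNorms.opNorm_sq_le_sum_norm_sq (Y ⟨x, μ⟩)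
  have hfrobw : ∑ w ∈ B, (∑ a : Fin N, ∑ b : Fin N, ‖(Y ⟨transl x₀ w, μ⟩) a b‖ ^ 2) ≤ ∑ w ∈ B, (N * ‖Y ⟨transl x₀ w, μ⟩‖ ^ 2) :=
    Finset.sum_le_sum fun w _ => sum_sum_norm_sq_le_mul_opNorm_sq _
  calc ‖Y ⟨x, μ⟩‖ ^ 2 ≤ ∑ a : Fin N, ∑ b : Fin N, ‖(Y ⟨x, μ⟩) a b‖ ^ 2 := hop
    _ ≤ K4 * ∑ w ∈ B, (∑ a : Fin N, ∑ b : Fin N, ‖(Y ⟨transl x₀ w, μ⟩) a b‖ ^ 2) + 2 * (N : ℝ) ^ 2 * T := hfrob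
    _ ≤ K4 * ∑ w ∈ B, (N * ‖Y ⟨transl x₀ w, μ⟩‖ ^ 2) + 2 * (N : ℝ) ^ 2 * T := by
        have := mul_le_mul_of_nonneg_left hfrobw hK4pos
        linarith
    _ = K4 * N * ∑ w ∈ B, ‖Y ⟨transl x₀ w, μ⟩‖ ^ 2 + 2 * (N : ℝ) ^ 2 * T := by rw [← Finset.mul_sum]; ring

/-! ## §2 The two blocks of a coarse bond as translates of the base corner -/

/-- Label arithmetic of one coordinate: if `v / ℓ = t` then `ℓ·t ≤ v < ℓ·t + ℓ`. [folklore] -/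
theorem mul_le_and_lt_of_div_eq {v ℓ t : ℕ} (hℓ : 0 < ℓ) (h : v / ℓ = t) : ℓ * t ≤ v ∧ v < ℓ * t + ℓ := by
  constructor
  · have := Nat.div_mul_le_self v ℓ
    rw [h] at this
    linarith [Nat.mul_comm ℓ t]
  · have h2 : v / ℓ < t + 1 := by omega
    have := (Nat.div_lt_iff_lt_mul hℓ).mp h2
    linarith [Nat.mul_comm ℓ t]

/-- The coordinate identity behind the dictionary: `fine P k y κ + ((v − L^k·y_κ : ℕ) : ℤ) = x κ` when `L^k·y_κ ≤ v = (x κ).val`, and the wrapped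
variant `fine P k y κ + ((v + s : ℕ) : ℤ) = x κ` when `L^k·y_κ + (v + s) = sitesPerDir 0 + v`. [folklore] -/
theorem fine_add_cast_eq (y : Site P k) (x : Site P 0) (κ : Fin P.d) (w : ℕ)
    (hw : (P.L ^ k * (y κ).val + w) % P.sitesPerDir 0 = (x κ).val) :
    fine P k y κ + ((w : ℤ) : ZMod (P.sitesPerDir 0)) = x κ := by
  have h1 : fine P k y κ = ((P.L ^ k * (y κ).val : ℕ) : ZMod (P.sitesPerDir 0)) := rfl
  rw [h1, Int.cast_natCast, ← Nat.cast_add, ← ZMod.natCast_mod, hw, ZMod.natCast_zmod_val]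

/-- **One block**: if `iterBlockOf k x = y` then `x = transl (fine P k y) z` with `0 ≤ z_κ ≤ L^k − 1`. [cite: Balaban1984PropagatorsI, (1.6) p.18] -/
theorem exists_offset_of_iterBlockOf_eq (hk : k ≤ P.m + P.K) (y : Site P k) (x : Site P 0) (hx : iterBlockOf k x = y) :
    ∃ z : Zd P.d, (∀ κ, 0 ≤ z κ ∧ z κ ≤ (P.L : ℤ) ^ k - 1) ∧ transl (fine P k y) z = x := by
  have hℓ : 0 < P.L ^ k := pow_pos P.L_pos k
  have hdiv : ∀ κ, (x κ).val / P.L ^ k = (y κ).val := fun κ => by rw [← val_iterBlockOf k hk x κ, hx]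
  refine ⟨fun κ => (((x κ).val - P.L ^ k * (y κ).val : ℕ) : ℤ), fun κ => ?_, ?_⟩
  · obtain ⟨h1, h2⟩ := mul_le_and_lt_of_div_eq hℓ (hdiv κ)
    constructor
    · positivity
    · have : ((x κ).val - P.L ^ k * (y κ).val : ℕ) + 1 ≤ P.L ^ k := by omega
      have h3 : (((x κ).val - P.L ^ k * (y κ).val : ℕ) : ℤ) + 1 ≤ ((P.L ^ k : ℕ) : ℤ) := by exact_mod_cast this
      push_cast at h3
      linarith
  · funext κ
    rw [transl_apply]
    obtain ⟨h1, _⟩ := mul_le_and_lt_of_div_eq hℓ (hdiv κ)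
    apply fine_add_cast_eq y x κ
    rw [Nat.add_sub_cancel' h1]
    exact Nat.mod_eq_of_lt (ZMod.val_lt _)

/-- ★ **Two blocks**: if `iterBlockOf k x = y` or `iterBlockOf k x = y + e_{κ₀}` (the two `k`-blocks of the coarse bond `⟨y, κ₀⟩`), then `x = transl (fine P k y) z`
with `0 ≤ z_κ ≤ 2L^k − 1` for every `κ` (wrap-around of the coarse torus in the direction `κ₀` included: there the offset is `v + L^k` with `v < L^k`).
[cite: Balaban1984PropagatorsI, (1.6) p.18] -/
theorem exists_offset_of_iterBlockOf_eq_or_shift (hk : k ≤ P.m + P.K) (y : Site P k) (κ₀ : Fin P.d) (x : Site P 0)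
    (hx : iterBlockOf k x = y ∨ iterBlockOf k x = y.shift κ₀) :
    ∃ z : Zd P.d, (∀ κ, 0 ≤ z κ ∧ z κ ≤ 2 * (P.L : ℤ) ^ k - 1) ∧ transl (fine P k y) z = x := by
  have hℓ : 0 < P.L ^ k := pow_pos P.L_pos k
  have hℓZ : (1 : ℤ) ≤ (P.L : ℤ) ^ k := by exact_mod_cast hℓ
  rcases hx with h1 | h2
  · obtain ⟨z, hz, hzx⟩ := exists_offset_of_iterBlockOf_eq hk y x h1
    exact ⟨z, fun κ => ⟨(hz κ).1, by linarith [(hz κ).2]⟩, hzx⟩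
  · -- the block of `x` is `y + e_{κ₀}`
    have hn0 : P.L ^ k * P.sitesPerDir k = P.sitesPerDir 0 := pow_mul_sitesPerDir P hk
    have hdiv : ∀ κ, (x κ).val / P.L ^ k = ((y.shift κ₀) κ).val := fun κ => by rw [← val_iterBlockOf k hk x κ, h2]
    have hdiv_ne : ∀ κ, κ ≠ κ₀ → (x κ).val / P.L ^ k = (y κ).val := fun κ hκ => by
      rw [hdiv κ, B10StarCount.shift_apply_ne y hκ]
    -- the special coordinate
    have hval0 : ((y.shift κ₀) κ₀).val = ((y κ₀).val + 1) % P.sitesPerDir k := by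
      rw [B10StarCount.shift_apply_self, ZMod.val_add, ZMod.val_one_eq_one_mod, Nat.add_mod_mod]
    have ha : (y κ₀).val < P.sitesPerDir k := ZMod.val_lt _
    -- the offset in the special coordinate
    have hz0 : ∃ w : ℕ, P.L ^ k ≤ w ∧ w + 1 ≤ 2 * P.L ^ k ∧ (P.L ^ k * (y κ₀).val + w) % P.sitesPerDir 0 = (x κ₀).val := by
      by_cases hwrap : (y κ₀).val + 1 = P.sitesPerDir k
      · -- wrap-around: the block of `x` in direction `κ₀` is `0`
        have ht : (x κ₀).val / P.L ^ k = 0 := by rw [hdiv κ₀, hval0, hwrap, Nat.mod_self]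
        obtain ⟨_, hv⟩ := mul_le_and_lt_of_div_eq hℓ ht
        refine ⟨(x κ₀).val + P.L ^ k, by omega, by omega, ?_⟩
        have h5 : P.L ^ k * ((y κ₀).val + 1) = P.sitesPerDir 0 := by rw [hwrap, hn0]
        have h5' : P.L ^ k * (y κ₀).val + P.L ^ k = P.sitesPerDir 0 := by rw [← h5]; ring
        have hsum : P.L ^ k * (y κ₀).val + ((x κ₀).val + P.L ^ k) = (x κ₀).val + P.sitesPerDir 0 := by omega
        rw [hsum, Nat.add_mod_right]
        exact Nat.mod_eq_of_lt (ZMod.val_lt _)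
      · have hlt : (y κ₀).val + 1 < P.sitesPerDir k := by omega
        have ht : (x κ₀).val / P.L ^ k = (y κ₀).val + 1 := by rw [hdiv κ₀, hval0, Nat.mod_eq_of_lt hlt]
        obtain ⟨hv1, hv2⟩ := mul_le_and_lt_of_div_eq hℓ ht
        refine ⟨(x κ₀).val - P.L ^ k * (y κ₀).val, ?_, ?_, ?_⟩
        · have : P.L ^ k * ((y κ₀).val + 1) = P.L ^ k * (y κ₀).val + P.L ^ k := by ring
          omega
        · have : P.L ^ k * ((y κ₀).val + 1) = P.L ^ k * (y κ₀).val + P.L ^ k := by ring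
          omega
        · have h1' : P.L ^ k * (y κ₀).val ≤ (x κ₀).val := by
            have : P.L ^ k * ((y κ₀).val + 1) = P.L ^ k * (y κ₀).val + P.L ^ k := by ring
            omega
          rw [Nat.add_sub_cancel' h1']
          exact Nat.mod_eq_of_lt (ZMod.val_lt _)
    obtain ⟨w₀, hw₀1, hw₀2, hw₀3⟩ := hz0
    refine ⟨fun κ => if κ = κ₀ then (w₀ : ℤ) else (((x κ).val - P.L ^ k * (y κ).val : ℕ) : ℤ), fun κ => ?_, ?_⟩
    · dsimp only
      by_cases hκ : κ = κ₀
      · rw [if_pos hκ]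
        constructor
        · positivity
        · have h3 : (w₀ : ℤ) + 1 ≤ 2 * ((P.L ^ k : ℕ) : ℤ) := by exact_mod_cast hw₀2
          push_cast at h3
          linarith
      · rw [if_neg hκ]
        obtain ⟨h1, h2'⟩ := mul_le_and_lt_of_div_eq hℓ (hdiv_ne κ hκ)
        constructor
        · positivity
        · have : ((x κ).val - P.L ^ k * (y κ).val : ℕ) + 1 ≤ P.L ^ k := by omega
          have h3 : (((x κ).val - P.L ^ k * (y κ).val : ℕ) : ℤ) + 1 ≤ ((P.L ^ k : ℕ) : ℤ) := by exact_mod_cast this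
          push_cast at h3
          linarith
    · funext κ
      rw [transl_apply]
      by_cases hκ : κ = κ₀
      · subst hκ
        rw [if_pos rfl]
        exact fine_add_cast_eq y x κ w₀ hw₀3
      · rw [if_neg hκ]
        obtain ⟨h1, _⟩ := mul_le_and_lt_of_div_eq hℓ (hdiv_ne κ hκ)
        apply fine_add_cast_eq y x κ
        rw [Nat.add_sub_cancel' h1]
        exact Nat.mod_eq_of_lt (ZMod.val_lt _)

/-- The offsets of the two blocks lie in the box `Q_{2L^k}(0)` of the `ℤ^d` Campanato road. [folklore] -/
theorem offset_mem_box {z : Zd P.d} (hz : ∀ κ, 0 ≤ z κ ∧ z κ ≤ 2 * (P.L : ℤ) ^ k - 1) :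
    z ∈ box (0 : Zd P.d) (2 * (P.L : ℤ) ^ k) := by
  rw [mem_box]
  intro i
  obtain ⟨h0, h1⟩ := hz i
  rw [Pi.zero_apply, sub_zero, abs_le]
  constructor <;> linarith

/-! ## §3 The estimate on the two blocks of a coarse bond -/

/-- ★★ **THE SOURCED MEAN-VALUE ESTIMATE ON THE TWO `k`-BLOCKS OF A COARSE BOND (operator norm, consumer's letters).**  `d ≥ 1`, `k ≤ m + K`,
`ℓ = L^k`, `R := 2ℓ + ℓ + d(ℓ+2)`, `c : PBond P k`, `x₀ := fine P k c.src`; if `‖curl 1 Y‖ ≤ c₁` on every plaquette based at `transl x₀ w`, `w ∈ Q_{R+1}(0)`, and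
`‖diverg 1 Y (transl x₀ w)‖ ≤ c₂` for `w ∈ Q_{R+2}(0)` (`c₁, c₂ ≥ 0`), then for EVERY fine bond `b` with `iterBlockOf k b.src = c.src ∨ iterBlockOf k b.src = c.tgt`:
`‖Y b‖² ≤ 4K·N·Σ_{w ∈ Q_R(0)} ‖Y⟨transl x₀ w, b.dir⟩‖² + 2N²·(4K(2R+1)^d + 2)·(64·2^d·d·(c₁+c₂)·(2R+1))²`, `K = 2^d(1+56d)^d(ℓ+1)^{−d}` — the flat linear core of
route R's displayed `C_reg`∕`hreg` input WITH SOURCES, k-uniform (`K(2R+1)^d ≤ 2^d(1+56d)^d(2d+7)^d`). [folklore]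
[cite: Giaquinta1984, Ch. III §2 (2.5) p.78; Balaban1984PropagatorsI, (1.6) p.18, (1.21) p.21; Balaban1984PropagatorsII, (1.9) p.226] -/
theorem normSq_le_of_curl_diverg_bounds_twoBlock {N : ℕ} (hd : 1 ≤ P.d) (hk : k ≤ P.m + P.K) (c : PBond P k)
    (Y : PBond P 0 → Matrix (Fin N) (Fin N) ℂ) {c₁ c₂ : ℝ} (hc₁ : 0 ≤ c₁) (hc₂ : 0 ≤ c₂)
    (hC : ∀ w ∈ box (0 : Zd P.d) (2 * (P.L : ℤ) ^ k + (P.L ^ k : ℕ) + P.d * (((P.L ^ k : ℕ) : ℤ) + 2) + 1), ∀ (ν μ : Fin P.d) (hνμ : ν < μ),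
      ‖curl 1 Y ⟨transl (fine P k c.src) w, ν, μ, hνμ⟩‖ ≤ c₁)
    (hDv : ∀ w ∈ box (0 : Zd P.d) (2 * (P.L : ℤ) ^ k + (P.L ^ k : ℕ) + P.d * (((P.L ^ k : ℕ) : ℤ) + 2) + 2),
      ‖diverg 1 Y (transl (fine P k c.src) w)‖ ≤ c₂)
    (b : PBond P 0) (hb : iterBlockOf k b.src = c.src ∨ iterBlockOf k b.src = c.tgt) :
    ‖Y b‖ ^ 2 ≤
      4 * ((2 : ℝ) ^ P.d * (1 + 56 * P.d) ^ P.d / (((P.L ^ k : ℕ) : ℝ) + 1) ^ P.d) * N *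
          ∑ w ∈ box (0 : Zd P.d) (2 * (P.L : ℤ) ^ k + (P.L ^ k : ℕ) + P.d * (((P.L ^ k : ℕ) : ℤ) + 2)),
            ‖Y ⟨transl (fine P k c.src) w, b.dir⟩‖ ^ 2 +
        2 * (N : ℝ) ^ 2 * ((4 * ((2 : ℝ) ^ P.d * (1 + 56 * P.d) ^ P.d / (((P.L ^ k : ℕ) : ℝ) + 1) ^ P.d) *
            (2 * ((2 * (P.L : ℤ) ^ k + (P.L ^ k : ℕ) + P.d * (((P.L ^ k : ℕ) : ℤ) + 2) : ℤ) : ℝ) + 1) ^ P.d + 2) *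
          (64 * (2 : ℝ) ^ P.d * P.d * (c₁ + c₂) * (2 * ((2 * (P.L : ℤ) ^ k + (P.L ^ k : ℕ) + P.d * (((P.L ^ k : ℕ) : ℤ) + 2) : ℤ) : ℝ) + 1)) ^ 2) := by
  have hPB : c.tgt = c.src.shift c.dir := rfl
  rw [hPB] at hb
  obtain ⟨z, hz, hzx⟩ := exists_offset_of_iterBlockOf_eq_or_shift hk c.src c.dir b.src hb
  have hzbox : z ∈ box (0 : Zd P.d) (2 * (P.L : ℤ) ^ k) := offset_mem_box hz
  have hℓ1 : 1 ≤ P.L ^ k := Nat.one_le_pow _ _ P.L_pos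
  have hρ₀ : (0 : ℤ) ≤ 2 * (P.L : ℤ) ^ k := by positivity
  have hb' : b = ⟨transl (fine P k c.src) z, b.dir⟩ := by
    cases b; simp only at hzx ⊢; rw [hzx]
  have h := normSq_le_of_curl_diverg_bounds_torus (N := N) hd (fine P k c.src) Y hℓ1 hρ₀ hc₁ hc₂ hC hDv hzbox b.dir
  rw [hb']
  exact h

end Summit.QuantumFields.YangMills.Theorems.Prop7FlatSourcedMeanValueMatrix

end
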